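import Summits.QuantumFields.YangMills.Theorems.BalabanUVNodesN15KingModelGaussianLawIdentification
import Summits.QuantumFields.YangMills.Theorems.BalabanUVNodesN15KingModelWickFourPoint
import Summits.QuantumFields.YangMills.Theorems.BalabanUVNodesN15KingModelBlockFieldMeasureContinuumLimit

/-!
# BalabanUVNodes ∕ N15 — THE KING-MODEL RUNG (PART Ϝ-v): KING's RENORMALIZED FREE BLOCK-FIELD MEASURES `dμ^{(K)} = ρ_{Δ^{(K)}}(ψ)dψ` ((2.6)∕(2.17),
# `η = 0`) ARE THE GAUSSIAN FIELDS OF KERNEL `(Δ^{(K)})⁻¹` (THE BLOCK COVARIANCE), `dμ^{(∞)} = gaussianFieldOfKernel C^{(∞)}` WITH `C^{(∞)}` IN CLOSED FORM;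
# their covariances, Wick four-point functions, one-dimensional marginals, and the convergence of second and fourth moments as `K → ∞`
# (Track A, DAG node N15 = NE2; FAN-OUT v1.1 §N15 s3 «KING-MODEL RUNG»; uses parts Ϡ-g∕Ϡ-k∕Ϡ-l (g32), Ϝ-s, Ϝ-t, Ϝ-u; count-neutral)

HONEST FRAMING.  Count-neutral (cell `pub-ymgap`, seat `pub-ymgap-dag-n15-e` g33; `--supports stmt-QuantumFields-27366 --as helper` = K3⁸
`SpineGivenEndpointR13SepCoPHV`).  [King1986] (C. King, Commun. Math. Phys. **102** (1986) 649–677): the measures of Theorem 2.1 at `g = 0`, `A = 0`,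
`η = 0` are the centred Gaussian laws `ρ_{Δ^{(K)}}(ψ)dψ` on `ℝ^Ω` with King's effective Laplacian `Δ^{(K)}` ((2.14), (4.5)) as precision (parts Ϡ-k∕Ϡ-l
typed their MGFs and the `K → ∞` limit `Δ^{(∞)}` with `(Δ^{(∞)})⁻¹ = C^{(∞)}` = `blockCovLim` in closed form).  By part Ϝ-u's identification theorem
(`gaussLaw_eq_gaussianFieldOfKernel`, folklore: MGF ⇒ complex MGF ⇒ law, Kallenberg 13.1) these laws ARE the tree's Kolmogorov-built Gaussian fields:
★★★ `gaussLaw Δ^{(K)} = gaussianFieldOfKernel (blockCov K)` (`K ≥ 1`) and ★★★ `gaussLaw Δ^{(∞)} = gaussianFieldOfKernel C^{(∞)}`, both `IsGaussian`;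
the smeared field `⟨J,ψ⟩` is `gaussianReal 0 ⟨J,(Δ^{(K)})⁻¹J⟩`; the covariances are `(Δ^{(K)})⁻¹` ∕ `C^{(∞)}` and the four-point functions their three
pairings (parts Ϝ-s∕Ϝ-t); second and fourth moments converge as `K → ∞` by part Ϡ-g's `tendsto_blockCov`.  Free massive scalar field only; nothing
Bałaban ∕ continuum-Yang–Mills ∕ `ℝ⁴` ∕ OS ∕ mass-gap ∕ Clay; N15 is booked through n15-a's knit, untouched here.  0 `sorry`, 0 def; standard axioms.

WHAT THIS FILE PROVES (kernel).  `unifCoercive_pos`, `limCoercive_pos`; ★★★ **`blockFieldLaw_eq_gaussianFieldOfKernel`**, ★★★ **`blockFieldLawLim_eq_gaussianFieldOfKernel`**,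
★★ `isGaussian_blockFieldLaw(_Lim)`, ★★ `map_dot_blockFieldLaw(_Lim)`, ★★ `integral_eval_mul_blockFieldLaw` (`= blockCov`), ★★ `integral_eval_mul_blockFieldLawLim`
(`= blockCovLim`), ★★ `integral_eval_mul_four_blockFieldLaw(_Lim)` (Wick), `integral_eval_blockFieldLaw`, ★★ `tendsto_integral_eval_mul_blockFieldLaw`,
★★ `tendsto_integral_eval_mul_four_blockFieldLaw`.
-/

noncomputable section

open scoped BigOperators NNReal ENNReal
open Finset Matrix Filter Topology MeasureTheory ProbabilityTheory

namespace Summit.QuantumFields.YangMills.BalabanUVNodes.N15KingModelRung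

open Literature.MathematicalPhysics.QuantumFieldTheory (gaussianFieldOfKernel)
open Literature.MathematicalPhysics.QuantumFieldTheory.Balaban1983to89.B5Prop11Plancherel (Tor)
open Literature.MathematicalPhysics.QuantumFieldTheory.Balaban1983to89.QGQInverse (Coercive isUnit_of_coercive)
open Literature.MathematicalPhysics.QuantumFieldTheory.King1986 (aK aK_pos)
open Literature.MathematicalPhysics.QuantumFieldTheory.King1986.Torus
open FreeField

section King

variable {d : ℕ} (L : ℕ) (M : Fin (d + 1) → ℕ) [hM : ∀ ν, NeZero (M ν)]

/-- The uniform coercivity constant `δ_∞ = (a_∞⁻¹ + m⁻²)⁻¹` is positive. [cite: King1986, (2.16) p.653, (4.33) p.674] -/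
theorem unifCoercive_pos (hL : 2 ≤ L) {a m2 : ℝ} (ha : 0 < a) (hm : 0 < m2) : 0 < ((aInf a L)⁻¹ + m2⁻¹)⁻¹ := by
  have hL1 : (1 : ℝ) < L := by exact_mod_cast (show 1 < L by omega)
  have := aInf_pos ha hL1
  positivity

/-- The limit coercivity constant `γ_∞ = a_∞∕(1 + a_∞B)` of part Ϡ-g is positive. [cite: King1986, (4.33) p.674] -/
theorem limCoercive_pos (hL : 2 ≤ L) {a m2 : ℝ} (ha : 0 < a) (hm : 0 < m2) :
    0 < aInf a L / (1 + aInf a L * ((Real.pi / 2) ^ (2 * (d + 1)) * Real.pi ^ (d + 1) / m2 * (1 + 4 / Real.pi) ^ (d + 1))) := by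
  have hL1 : (1 : ℝ) < L := by exact_mod_cast (show 1 < L by omega)
  have := aInf_pos ha hL1
  positivity

/-- ★★★ **KING's LEVEL-`K` FREE BLOCK-FIELD MEASURE IS THE GAUSSIAN FIELD OF KERNEL `(Δ^{(K)})⁻¹`**: `ρ_{Δ^{(K)}}(ψ)dψ = gaussianFieldOfKernel (blockCov K)`
(`K ≥ 1`, `a, m² > 0`, `L ≥ 2`, every unit torus). [cite: King1986, (2.6) p.652, (2.14)–(2.17) p.653, (4.5) p.670] -/
theorem blockFieldLaw_eq_gaussianFieldOfKernel (hL : 2 ≤ L) {a m2 : ℝ} (ha : 0 < a) (hm : 0 < m2) {K : ℕ} (hK : 1 ≤ K) :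
    haveI : NeZero L := ⟨by omega⟩
    gaussLaw (effLaplacian (L ^ K) M (aK a L K) (((L ^ K : ℕ) : ℝ) ^ 2) m2) = gaussianFieldOfKernel (blockCov L (L ^ K) M a m2 K) := by
  haveI : NeZero L := ⟨by omega⟩
  rw [gaussLaw_eq_gaussianFieldOfKernel (unifCoercive_pos L hL ha hm) (coercive_effLaplacian_unif L M hL ha hm hK) (effLaplacian_transpose_eq (L ^ K) M _ _ _)]
  rfl

/-- ★★★ **THE LIMIT MEASURE IS THE GAUSSIAN FIELD OF KERNEL `C^{(∞)}`** (King's continuum unit-lattice action `½⟨ψ,Δ^{(∞)}ψ⟩`; `(Δ^{(∞)})⁻¹ = C^{(∞)}` explicit,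
part Ϡ-g). [cite: King1986, (2.6) p.652, (2.14)–(2.16) p.653, Thm 2.1 (2.22) p.654] -/
theorem blockFieldLawLim_eq_gaussianFieldOfKernel (hLodd : Odd L) (hL : 2 ≤ L) {a m2 : ℝ} (ha : 0 < a) (hm : 0 < m2) :
    gaussLaw (Matrix.of fun b b' => effLaplacianLim L M a m2 b b') = gaussianFieldOfKernel (blockCovLim L M a m2) := by
  rw [gaussLaw_eq_gaussianFieldOfKernel (limCoercive_pos L hL ha hm) (coercive_effLaplacianLim L M hLodd hL ha hm) (effLaplacianLim_transpose_eq L M a m2),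
    ← blockCovLim_eq_inv L M hLodd hL ha hm]
  rfl

/-- ★★ The level-`K` block-field measure is a Gaussian measure on `ℝ^Ω`. [cite: King1986, (2.6) p.652] -/
theorem isGaussian_blockFieldLaw (hL : 2 ≤ L) {a m2 : ℝ} (ha : 0 < a) (hm : 0 < m2) {K : ℕ} (hK : 1 ≤ K) :
    haveI : NeZero L := ⟨by omega⟩
    IsGaussian (gaussLaw (effLaplacian (L ^ K) M (aK a L K) (((L ^ K : ℕ) : ℝ) ^ 2) m2)) := by
  haveI : NeZero L := ⟨by omega⟩
  exact isGaussian_gaussLaw (unifCoercive_pos L hL ha hm) (coercive_effLaplacian_unif L M hL ha hm hK) (effLaplacian_transpose_eq (L ^ K) M _ _ _)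

/-- ★★ The limit measure is a Gaussian measure. [cite: King1986, (2.6) p.652, Thm 2.1 (2.22) p.654] -/
theorem isGaussian_blockFieldLawLim (hLodd : Odd L) (hL : 2 ≤ L) {a m2 : ℝ} (ha : 0 < a) (hm : 0 < m2) :
    IsGaussian (gaussLaw (Matrix.of fun b b' => effLaplacianLim L M a m2 b b')) :=
  isGaussian_gaussLaw (limCoercive_pos L hL ha hm) (coercive_effLaplacianLim L M hLodd hL ha hm) (effLaplacianLim_transpose_eq L M a m2)

/-- ★★ **THE SMEARED BLOCK FIELD IS A REAL GAUSSIAN**: `⟨J,ψ⟩ ∼ 𝒩(0, ⟨J,(Δ^{(K)})⁻¹J⟩)` under `dμ^{(K)}`. [cite: King1986, (2.6) p.652, (2.14) p.653] -/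
theorem map_dot_blockFieldLaw (hL : 2 ≤ L) {a m2 : ℝ} (ha : 0 < a) (hm : 0 < m2) {K : ℕ} (hK : 1 ≤ K) (J : Tor M → ℝ) :
    haveI : NeZero L := ⟨by omega⟩
    (gaussLaw (effLaplacian (L ^ K) M (aK a L K) (((L ^ K : ℕ) : ℝ) ^ 2) m2)).map (fun ψ : Tor M → ℝ => J ⬝ᵥ ψ)
      = gaussianReal 0 (J ⬝ᵥ ((effLaplacian (L ^ K) M (aK a L K) (((L ^ K : ℕ) : ℝ) ^ 2) m2)⁻¹ *ᵥ J)).toNNReal := by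
  haveI : NeZero L := ⟨by omega⟩
  exact map_dot_gaussLaw (unifCoercive_pos L hL ha hm) (coercive_effLaplacian_unif L M hL ha hm hK) (effLaplacian_transpose_eq (L ^ K) M _ _ _) J

/-- ★★ `⟨J,ψ⟩ ∼ 𝒩(0, ⟨J, C^{(∞)}J⟩)` under `dμ^{(∞)}`. [cite: King1986, (2.6) p.652, Thm 2.1 (2.22) p.654] -/
theorem map_dot_blockFieldLawLim (hLodd : Odd L) (hL : 2 ≤ L) {a m2 : ℝ} (ha : 0 < a) (hm : 0 < m2) (J : Tor M → ℝ) :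
    (gaussLaw (Matrix.of fun b b' => effLaplacianLim L M a m2 b b')).map (fun ψ : Tor M → ℝ => J ⬝ᵥ ψ)
      = gaussianReal 0 (J ⬝ᵥ ((Matrix.of fun b b' => blockCovLim L M a m2 b b') *ᵥ J)).toNNReal := by
  rw [map_dot_gaussLaw (limCoercive_pos L hL ha hm) (coercive_effLaplacianLim L M hLodd hL ha hm) (effLaplacianLim_transpose_eq L M a m2),
    ← blockCovLim_eq_inv L M hLodd hL ha hm]

/-- ★★ **THE COVARIANCE OF `dμ^{(K)}` IS THE BLOCK COVARIANCE**: `∫ ψ(x)ψ(y) ρ_{Δ^{(K)}}(ψ)dψ = (Δ^{(K)})⁻¹(x,y) = blockCov K x y`.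
[cite: King1986, (2.6) p.652, (2.10)–(2.14) pp.652–653] -/
theorem integral_eval_mul_blockFieldLaw (hL : 2 ≤ L) {a m2 : ℝ} (ha : 0 < a) (hm : 0 < m2) {K : ℕ} (hK : 1 ≤ K) (x y : Tor M) :
    haveI : NeZero L := ⟨by omega⟩
    ∫ ψ : Tor M → ℝ, ψ x * ψ y * gaussDensity (effLaplacian (L ^ K) M (aK a L K) (((L ^ K : ℕ) : ℝ) ^ 2) m2) ψ = blockCov L (L ^ K) M a m2 K x y := by
  haveI : NeZero L := ⟨by omega⟩
  exact integral_eval_mul_gaussDensity (unifCoercive_pos L hL ha hm) (coercive_effLaplacian_unif L M hL ha hm hK) (effLaplacian_transpose_eq (L ^ K) M _ _ _) x y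

/-- ★★ **THE COVARIANCE OF `dμ^{(∞)}` IS `C^{(∞)}`** (closed form). [cite: King1986, (2.6) p.652, Thm 2.1 (2.22) p.654] -/
theorem integral_eval_mul_blockFieldLawLim (hLodd : Odd L) (hL : 2 ≤ L) {a m2 : ℝ} (ha : 0 < a) (hm : 0 < m2) (x y : Tor M) :
    ∫ ψ : Tor M → ℝ, ψ x * ψ y * gaussDensity (Matrix.of fun b b' => effLaplacianLim L M a m2 b b') ψ = blockCovLim L M a m2 x y := by
  rw [integral_eval_mul_gaussDensity (limCoercive_pos L hL ha hm) (coercive_effLaplacianLim L M hLodd hL ha hm) (effLaplacianLim_transpose_eq L M a m2),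
    ← blockCovLim_eq_inv L M hLodd hL ha hm, Matrix.of_apply]

/-- `dμ^{(K)}` is centred. [folklore] -/
theorem integral_eval_blockFieldLaw (hL : 2 ≤ L) {a m2 : ℝ} (ha : 0 < a) (hm : 0 < m2) {K : ℕ} (hK : 1 ≤ K) (x : Tor M) :
    haveI : NeZero L := ⟨by omega⟩
    ∫ ψ : Tor M → ℝ, ψ x * gaussDensity (effLaplacian (L ^ K) M (aK a L K) (((L ^ K : ℕ) : ℝ) ^ 2) m2) ψ = 0 := by
  haveI : NeZero L := ⟨by omega⟩
  exact integral_eval_gaussDensity (unifCoercive_pos L hL ha hm) (coercive_effLaplacian_unif L M hL ha hm hK) (effLaplacian_transpose_eq (L ^ K) M _ _ _) x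

/-- ★★ **WICK FOR THE BLOCK FIELD**: `∫ ψ(w)ψ(x)ψ(y)ψ(z) dμ^{(K)} = Σ_{pairings} (Δ^{(K)})⁻¹(Δ^{(K)})⁻¹` (part Ϝ-t). [cite: King1986, (2.6) p.652, (2.14) p.653] -/
theorem integral_eval_mul_four_blockFieldLaw (hL : 2 ≤ L) {a m2 : ℝ} (ha : 0 < a) (hm : 0 < m2) {K : ℕ} (hK : 1 ≤ K) (w x y z : Tor M) :
    haveI : NeZero L := ⟨by omega⟩
    ∫ ψ : Tor M → ℝ, ψ w * ψ x * ψ y * ψ z * gaussDensity (effLaplacian (L ^ K) M (aK a L K) (((L ^ K : ℕ) : ℝ) ^ 2) m2) ψ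
      = blockCov L (L ^ K) M a m2 K w x * blockCov L (L ^ K) M a m2 K y z + blockCov L (L ^ K) M a m2 K w y * blockCov L (L ^ K) M a m2 K x z
        + blockCov L (L ^ K) M a m2 K w z * blockCov L (L ^ K) M a m2 K x y := by
  haveI : NeZero L := ⟨by omega⟩
  exact integral_eval_mul_four_gaussDensity (unifCoercive_pos L hL ha hm) (coercive_effLaplacian_unif L M hL ha hm hK)
    (effLaplacian_transpose_eq (L ^ K) M _ _ _) w x y z

/-- ★★ **WICK FOR THE LIMIT FIELD** with `C^{(∞)}`. [cite: King1986, (2.6) p.652, Thm 2.1 (2.22) p.654] -/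
theorem integral_eval_mul_four_blockFieldLawLim (hLodd : Odd L) (hL : 2 ≤ L) {a m2 : ℝ} (ha : 0 < a) (hm : 0 < m2) (w x y z : Tor M) :
    ∫ ψ : Tor M → ℝ, ψ w * ψ x * ψ y * ψ z * gaussDensity (Matrix.of fun b b' => effLaplacianLim L M a m2 b b') ψ
      = blockCovLim L M a m2 w x * blockCovLim L M a m2 y z + blockCovLim L M a m2 w y * blockCovLim L M a m2 x z
        + blockCovLim L M a m2 w z * blockCovLim L M a m2 x y := by
  rw [integral_eval_mul_four_gaussDensity (limCoercive_pos L hL ha hm) (coercive_effLaplacianLim L M hLodd hL ha hm) (effLaplacianLim_transpose_eq L M a m2),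
    ← blockCovLim_eq_inv L M hLodd hL ha hm]
  simp only [Matrix.of_apply]

/-- ★★ **SECOND MOMENTS CONVERGE** `K → ∞` (covariances `blockCov K → C^{(∞)}`, part Ϡ-g). [cite: King1986, Thm 2.1 (2.22) p.654, Thm 3.4 (3.9) p.656] -/
theorem tendsto_integral_eval_mul_blockFieldLaw (hLodd : Odd L) (hL : 2 ≤ L) {a m2 : ℝ} (ha : 0 < a) (hm : 0 < m2) (x y : Tor M) :
    haveI : NeZero L := ⟨by omega⟩
    Tendsto (fun K : ℕ => ∫ ψ : Tor M → ℝ, ψ x * ψ y * gaussDensity (effLaplacian (L ^ K) M (aK a L K) (((L ^ K : ℕ) : ℝ) ^ 2) m2) ψ) atTop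
      (𝓝 (∫ ψ : Tor M → ℝ, ψ x * ψ y * gaussDensity (Matrix.of fun b b' => effLaplacianLim L M a m2 b b') ψ)) := by
  haveI : NeZero L := ⟨by omega⟩
  rw [integral_eval_mul_blockFieldLawLim L M hLodd hL ha hm x y]
  refine (tendsto_blockCov L M hLodd hL ha hm x y).congr' ?_
  filter_upwards [eventually_ge_atTop 1] with K hK
  exact (integral_eval_mul_blockFieldLaw L M hL ha hm hK x y).symm

/-- ★★ **FOURTH MOMENTS CONVERGE** `K → ∞`. [cite: King1986, Thm 2.1 (2.22) p.654] -/
theorem tendsto_integral_eval_mul_four_blockFieldLaw (hLodd : Odd L) (hL : 2 ≤ L) {a m2 : ℝ} (ha : 0 < a) (hm : 0 < m2) (w x y z : Tor M) :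
    haveI : NeZero L := ⟨by omega⟩
    Tendsto (fun K : ℕ => ∫ ψ : Tor M → ℝ, ψ w * ψ x * ψ y * ψ z
        * gaussDensity (effLaplacian (L ^ K) M (aK a L K) (((L ^ K : ℕ) : ℝ) ^ 2) m2) ψ) atTop
      (𝓝 (∫ ψ : Tor M → ℝ, ψ w * ψ x * ψ y * ψ z * gaussDensity (Matrix.of fun b b' => effLaplacianLim L M a m2 b b') ψ)) := by
  haveI : NeZero L := ⟨by omega⟩
  rw [integral_eval_mul_four_blockFieldLawLim L M hLodd hL ha hm w x y z]
  have t := tendsto_blockCov L M hLodd hL ha hm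
  refine ((((t w x).mul (t y z)).add ((t w y).mul (t x z))).add ((t w z).mul (t x y))).congr' ?_
  filter_upwards [eventually_ge_atTop 1] with K hK
  exact (integral_eval_mul_four_blockFieldLaw L M hL ha hm hK w x y z).symm

end King

end Summit.QuantumFields.YangMills.BalabanUVNodes.N15KingModelRung

end
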